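import Literature.AlgebraicGeometry.ProjectiveSpace.EdgeIdealMinimalVertexCovers
import Literature.AlgebraicGeometry.ProjectiveSpace.StanleyReisnerKrullDimension
import HarnessLib

/-!
# The barycentric subdivision: `Δ` is pure iff `bs(Δ)` is pure iff the non-comparability graph
# `G(Δ)` is well-covered (Zaare-Nahandi 2015, §1 and Lemma 2.1)

Topic `Literature/AlgebraicGeometry/ProjectiveSpace`, namespace
`Literature.AlgebraicGeometry.ProjectiveSpace`. Lane `lit-hodgefound`, seat `lit-hodgefound-p32`,
row gen31-#3. Theorems only (no `def`, no named fact). Uses `EdgeIdealMinimalVertexCovers`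
(gen31-#1: `Δ(G)` pure `⟺` `G` well-covered) and the order complexes of `FlagComplexStanleyReisner`
(gen30-#9).

## The source, as printed

R. Zaare-Nahandi, *Pure simplicial complexes and well-covered graphs*, §1: "An element of `Δ` is
called a face and a maximal face with respect to inclusion is called a facet. … A simplicial complex
is called pure if all of its facets have the same dimension. … Let `Δ` be a simplicial complex on the
vertex set `[n]`. The barycentric subdivision of `Δ`, denoted by `bs(Δ)`, is a simplicial complex
with vertex set consisting of all nonempty faces of `Δ`. A face in `bs(Δ)` consists of comparable
vertices, that is, two vertices lie in a face in `bs(Δ)` if one is a subset of the other. In other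
words, facets of `bs(Δ)` are maximal chains of faces of `Δ` considered as a poset with respect to
inclusion order. It is easy to see that the minimal non-faces of `bs(Δ)` are subsets of `Δ` with
exactly two non-comparable elements. Therefore, `bs(Δ)` is an independence complex of a graph. In
fact this graph is non-comparability graph of `Δ`. Vertices of the graph are nonempty faces of `Δ`
and two vertices are adjacent if their corresponding faces are not comparable. This graph is denoted
by `G(Δ)`. It is known that the dimension (and many other invariants) of a simplicial complex and its
barycentric subdivision are equal ([BW] and [KW]). Specially a simplicial complex `Δ` is pure if and
only if its barycentric subdivision is pure and it is equal to say that the graph `G(Δ)` is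
well-covered." **Lemma 2.1.** "Let `Δ` be a simplicial complex. Then, `G(Δ)` is in the class `𝒢`.
Moreover, `Δ` is pure if and only if `G(Δ)` is well-covered."

## Dictionary and what is here

`Δ : Finset (Finset V)` generates the complex of the subsets of its members (faces
`Δ.biUnion powerset`, facets = `Maximal (· ∈ Δ)` members, as in the Stanley–Reisner files of this
directory). The barycentric subdivision is the complex ON THE VERTEX TYPE `Finset V` whose faces are
the finite CHAINS (pairwise `⊆`-comparable families) of NONEMPTY faces of `Δ`:
`bs(Δ) = univ.filter (fun 𝒞 => (∀ A ∈ 𝒞, A.Nonempty ∧ A ∈ Δ.biUnion powerset) ∧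
  ∀ A ∈ 𝒞, ∀ B ∈ 𝒞, A ⊆ B ∨ B ⊆ A)` (subsets of `V` that are not nonempty faces are non-vertices).

* § 1 chains of finite sets: the top member, injectivity of the cardinality, `|𝒞| ≤ |T|` for chains
  of nonempty subsets of `T`, and the **saturation lemma**: a chain of nonempty subsets of its top `T`
  that cannot be enlarged inside `T` has exactly `|T|` members.
* § 2 `bs(Δ)` is a simplicial complex; **the top of a facet of `bs(Δ)` is a facet `T` of `Δ` and the
  facet has `|T|` members** ("facets of `bs(Δ)` are maximal chains of faces"); every nonempty facet of
  `Δ` is such a top; **`dim bs(Δ) = dim Δ`** (`max |𝒞| = max |F|`), also as Krull dimensions of the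
  two Stanley–Reisner rings (`k` infinite).
* § 3 **`Δ` is pure iff `bs(Δ)` is pure.**
* § 4 the minimal non-faces: a family of subsets of `V` is a non-face of `bs(Δ)` iff it contains a
  non-vertex or two non-comparable members; the Stanley–Reisner ideal of `bs(Δ)` is generated by the
  non-vertices `x_A` and the products `x_A x_B` of non-comparable nonempty faces (`k` infinite).
* § 5 the non-comparability graph `G(Δ)` on the type of nonempty faces: `bs(Δ)` is its independence
  complex (= the order complex of the face poset, gen30-#9), the facets correspond under the
  forgetful embedding, and **Lemma 2.1: `Δ` is pure iff `G(Δ)` is well-covered**.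

## References

* [ZaareNahandi2015] R. Zaare-Nahandi, *Pure simplicial complexes and well-covered graphs*, Rocky
  Mountain J. Math. 45 (2015), §1 and Lemma 2.1.
* [BrunsHerzog1998] W. Bruns, J. Herzog, *Cohen–Macaulay Rings*, Def. 5.1.1 (faces, facets, pure),
  Thm. 5.1.4 (`dim k[Δ] = dim Δ + 1`).
-/

noncomputable section

open Finset MvPolynomial
open Literature.RingTheory.MvPolynomial

universe u

namespace Literature.AlgebraicGeometry.ProjectiveSpace

variable {V : Type*} [DecidableEq V]

/-! ### § 1 Chains of finite sets -/

section Chains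

omit [DecidableEq V] in
/-- **A nonempty chain has a top member** (the member of largest cardinality contains all members).
[cite: ZaareNahandi2015, §1 ("maximal chains of faces")] -/
theorem exists_top_of_chain {𝒞 : Finset (Finset V)} (hne : 𝒞.Nonempty)
    (hchain : ∀ A ∈ 𝒞, ∀ B ∈ 𝒞, A ⊆ B ∨ B ⊆ A) : ∃ T ∈ 𝒞, ∀ A ∈ 𝒞, A ⊆ T := by
  obtain ⟨T, hT, hmax⟩ := 𝒞.exists_max_image Finset.card hne
  refine ⟨T, hT, fun A hA => ?_⟩
  rcases hchain A hA T hT with h | h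
  · exact h
  · exact (Finset.eq_of_subset_of_card_le h (hmax A hA)).ge

omit [DecidableEq V] in
/-- Distinct members of a chain have distinct cardinalities. [cite: ZaareNahandi2015, §1] -/
theorem card_injOn_of_chain {𝒞 : Finset (Finset V)}
    (hchain : ∀ A ∈ 𝒞, ∀ B ∈ 𝒞, A ⊆ B ∨ B ⊆ A) : Set.InjOn Finset.card (↑𝒞 : Set (Finset V)) := by
  intro A hA B hB hAB
  rcases hchain A (Finset.mem_coe.mp hA) B (Finset.mem_coe.mp hB) with h | h
  · exact Finset.eq_of_subset_of_card_le h hAB.ge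
  · exact (Finset.eq_of_subset_of_card_le h hAB.le).symm

omit [DecidableEq V] in
/-- **A chain of nonempty subsets of `T` has at most `|T|` members.** [cite: ZaareNahandi2015, §1] -/
theorem card_chain_le_card {𝒞 : Finset (Finset V)} {T : Finset V}
    (hchain : ∀ A ∈ 𝒞, ∀ B ∈ 𝒞, A ⊆ B ∨ B ⊆ A) (hsub : ∀ A ∈ 𝒞, A.Nonempty ∧ A ⊆ T) :
    𝒞.card ≤ T.card := by
  have h := Finset.card_le_card_of_injOn Finset.card (s := 𝒞) (t := Finset.Icc 1 T.card)
    (fun A hA => by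
      rw [Finset.mem_coe, Finset.mem_Icc]
      exact ⟨Finset.card_pos.mpr (hsub A (Finset.mem_coe.mp hA)).1,
        Finset.card_le_card (hsub A (Finset.mem_coe.mp hA)).2⟩)
    (card_injOn_of_chain hchain)
  rw [Nat.card_Icc] at h
  omega

omit [DecidableEq V] in
/-- **Saturation lemma: a chain of nonempty subsets of its top member `T` which already contains
every nonempty subset of `T` comparable with all its members has exactly `|T|` members** (otherwise a
cardinality `i` is skipped, and a set of cardinality `i` squeezed between the largest member below and
the smallest member above `i` could be added). [cite: ZaareNahandi2015, §1 ("maximal chains of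
faces")] -/
theorem card_eq_card_of_saturated_chain {𝒞 : Finset (Finset V)} {T : Finset V} (hT : T ∈ 𝒞)
    (hsub : ∀ A ∈ 𝒞, A.Nonempty ∧ A ⊆ T) (hchain : ∀ A ∈ 𝒞, ∀ B ∈ 𝒞, A ⊆ B ∨ B ⊆ A)
    (hsat : ∀ M : Finset V, M.Nonempty → M ⊆ T → (∀ A ∈ 𝒞, A ⊆ M ∨ M ⊆ A) → M ∈ 𝒞) :
    𝒞.card = T.card := by
  classical
  refine le_antisymm (card_chain_le_card hchain hsub) ?_
  by_contra hlt
  push Not at hlt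
  -- some cardinality `i ∈ [1, |T|]` is skipped
  have hskip : ∃ i, 1 ≤ i ∧ i ≤ T.card ∧ ∀ A ∈ 𝒞, A.card ≠ i := by
    by_contra hall
    push Not at hall
    have hsubset : Finset.Icc 1 T.card ⊆ 𝒞.image Finset.card := by
      intro i hi
      rw [Finset.mem_Icc] at hi
      obtain ⟨A, hA, hAi⟩ := hall i hi.1 hi.2
      exact Finset.mem_image.mpr ⟨A, hA, hAi⟩
    have h1 := Finset.card_le_card hsubset
    rw [Nat.card_Icc] at h1
    have h2 := Finset.card_image_le (s := 𝒞) (f := Finset.card)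
    omega
  obtain ⟨i, hi1, hiT, hmiss⟩ := hskip
  -- the members above `i`, and the smallest of them
  have hTi : i < T.card := lt_of_le_of_ne hiT (fun h => hmiss T hT h.symm)
  obtain ⟨B₀, hB₀, hB₀min⟩ := (𝒞.filter (fun B => i < B.card)).exists_min_image Finset.card
    ⟨T, Finset.mem_filter.mpr ⟨hT, hTi⟩⟩
  have hB₀𝒞 : B₀ ∈ 𝒞 := (Finset.mem_filter.mp hB₀).1
  have hB₀i : i < B₀.card := (Finset.mem_filter.mp hB₀).2
  -- a lower bound `A₀ ⊆ B₀` of cardinality `< i` containing all members below `i`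
  have hlow : ∃ A₀ : Finset V, A₀ ⊆ B₀ ∧ A₀.card < i ∧
      ∀ A ∈ 𝒞.filter (fun A => A.card < i), A ⊆ A₀ := by
    by_cases h𝒜 : (𝒞.filter (fun A => A.card < i)).Nonempty
    · obtain ⟨A₀, hA₀, hA₀max⟩ := (𝒞.filter (fun A => A.card < i)).exists_max_image Finset.card h𝒜
      have hA₀𝒞 : A₀ ∈ 𝒞 := (Finset.mem_filter.mp hA₀).1
      have hA₀i : A₀.card < i := (Finset.mem_filter.mp hA₀).2
      refine ⟨A₀, ?_, hA₀i, fun A hA => ?_⟩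
      · rcases hchain A₀ hA₀𝒞 B₀ hB₀𝒞 with h | h
        · exact h
        · exfalso
          have := Finset.card_le_card h
          omega
      · rcases hchain A (Finset.mem_filter.mp hA).1 A₀ hA₀𝒞 with h | h
        · exact h
        · exact (Finset.eq_of_subset_of_card_le h (hA₀max A hA)).ge
    · exact ⟨∅, Finset.empty_subset _, by rw [Finset.card_empty]; omega,
        fun A hA => absurd ⟨A, hA⟩ h𝒜⟩
  obtain ⟨A₀, hA₀B₀, hA₀i, hA₀max⟩ := hlow
  -- squeeze a set of cardinality `i` in between
  obtain ⟨M, hA₀M, hMB₀, hMi⟩ :=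
    Finset.exists_subsuperset_card_eq hA₀B₀ (le_of_lt hA₀i) (le_of_lt hB₀i)
  refine hmiss M (hsat M (Finset.card_pos.mp (by omega)) (hMB₀.trans (hsub B₀ hB₀𝒞).2)
    fun A hA => ?_) hMi
  rcases lt_or_gt_of_ne (hmiss A hA) with h | h
  · exact Or.inl ((hA₀max A (Finset.mem_filter.mpr ⟨hA, h⟩)).trans hA₀M)
  · refine Or.inr (hMB₀.trans ?_)
    rcases hchain B₀ hB₀𝒞 A hA with h' | h'
    · exact h'
    · exact (Finset.eq_of_subset_of_card_le h' (hB₀min A (Finset.mem_filter.mpr ⟨hA, h⟩))).ge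

end Chains

/-! ### § 2 The barycentric subdivision and its facets -/

section Barycentric

variable [Fintype V]

/-- The faces of `bs(Δ)`, unfolded. [cite: ZaareNahandi2015, §1] -/
theorem mem_barycentricSubdivision_iff (Δ : Finset (Finset V)) (𝒞 : Finset (Finset V)) :
    𝒞 ∈ (univ : Finset (Finset (Finset V))).filter (fun 𝒞 =>
        (∀ A ∈ 𝒞, A.Nonempty ∧ A ∈ Δ.biUnion powerset) ∧ ∀ A ∈ 𝒞, ∀ B ∈ 𝒞, A ⊆ B ∨ B ⊆ A) ↔
      (∀ A ∈ 𝒞, A.Nonempty ∧ A ∈ Δ.biUnion powerset) ∧ ∀ A ∈ 𝒞, ∀ B ∈ 𝒞, A ⊆ B ∨ B ⊆ A := by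
  rw [Finset.mem_filter]
  exact and_iff_right (Finset.mem_univ _)

omit [Fintype V] in
/-- Faces of `Δ`, unfolded: `A ∈ Δ.biUnion powerset ⟺ A ⊆ F` for some `F ∈ Δ`.
[cite: BrunsHerzog1998, Def. 5.1.1] -/
theorem mem_biUnion_powerset_iff (Δ : Finset (Finset V)) (A : Finset V) :
    A ∈ Δ.biUnion powerset ↔ ∃ F ∈ Δ, A ⊆ F := by
  simp only [Finset.mem_biUnion, Finset.mem_powerset]

/-- **`bs(Δ)` is a simplicial complex** (a subfamily of a chain of nonempty faces is one).
[cite: ZaareNahandi2015, §1] -/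
theorem barycentricSubdivision_down_closed (Δ : Finset (Finset V)) :
    ∀ 𝒞 ∈ (univ : Finset (Finset (Finset V))).filter (fun 𝒞 =>
        (∀ A ∈ 𝒞, A.Nonempty ∧ A ∈ Δ.biUnion powerset) ∧ ∀ A ∈ 𝒞, ∀ B ∈ 𝒞, A ⊆ B ∨ B ⊆ A),
      ∀ 𝒞' ⊆ 𝒞, 𝒞' ∈ (univ : Finset (Finset (Finset V))).filter (fun 𝒞 =>
        (∀ A ∈ 𝒞, A.Nonempty ∧ A ∈ Δ.biUnion powerset) ∧ ∀ A ∈ 𝒞, ∀ B ∈ 𝒞, A ⊆ B ∨ B ⊆ A) := by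
  intro 𝒞 h𝒞 𝒞' h𝒞'
  rw [mem_barycentricSubdivision_iff] at h𝒞 ⊢
  exact ⟨fun A hA => h𝒞.1 A (h𝒞' hA), fun A hA B hB => h𝒞.2 A (h𝒞' hA) B (h𝒞' hB)⟩

/-- The vertices of `bs(Δ)` are the nonempty faces: `{A} ∈ bs(Δ) ⟺ A` is a nonempty face of `Δ`.
[cite: ZaareNahandi2015, §1 ("vertex set consisting of all nonempty faces")] -/
theorem singleton_mem_barycentricSubdivision_iff (Δ : Finset (Finset V)) (A : Finset V) :
    ({A} : Finset (Finset V)) ∈ (univ : Finset (Finset (Finset V))).filter (fun 𝒞 =>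
        (∀ A ∈ 𝒞, A.Nonempty ∧ A ∈ Δ.biUnion powerset) ∧ ∀ A ∈ 𝒞, ∀ B ∈ 𝒞, A ⊆ B ∨ B ⊆ A) ↔
      A.Nonempty ∧ A ∈ Δ.biUnion powerset := by
  rw [mem_barycentricSubdivision_iff]
  simp only [Finset.mem_singleton, forall_eq]
  exact ⟨fun h => h.1, fun h => ⟨h, Or.inl subset_rfl⟩⟩

/-- "Two vertices lie in a face in `bs(Δ)` if one is a subset of the other": `{A, B} ∈ bs(Δ)` iff
`A`, `B` are comparable nonempty faces. [cite: ZaareNahandi2015, §1] -/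
theorem pair_mem_barycentricSubdivision_iff (Δ : Finset (Finset V)) (A B : Finset V) :
    ({A, B} : Finset (Finset V)) ∈ (univ : Finset (Finset (Finset V))).filter (fun 𝒞 =>
        (∀ A ∈ 𝒞, A.Nonempty ∧ A ∈ Δ.biUnion powerset) ∧ ∀ A ∈ 𝒞, ∀ B ∈ 𝒞, A ⊆ B ∨ B ⊆ A) ↔
      (A.Nonempty ∧ A ∈ Δ.biUnion powerset) ∧ (B.Nonempty ∧ B ∈ Δ.biUnion powerset) ∧
        (A ⊆ B ∨ B ⊆ A) := by
  rw [mem_barycentricSubdivision_iff]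
  simp only [Finset.mem_insert, Finset.mem_singleton, forall_eq_or_imp, forall_eq]
  constructor
  · rintro ⟨⟨hA, hB⟩, ⟨-, hAB⟩, -⟩
    exact ⟨hA, hB, hAB⟩
  · rintro ⟨hA, hB, hAB⟩
    exact ⟨⟨hA, hB⟩, ⟨Or.inl subset_rfl, hAB⟩, hAB.symm, Or.inl subset_rfl⟩

/-- **The top of a facet of `bs(Δ)` is a facet `T` of `Δ`, and the facet has `|T|` members**
("facets of `bs(Δ)` are maximal chains of faces of `Δ`"; a maximal chain is saturated).
[cite: ZaareNahandi2015, §1] -/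
theorem exists_top_of_maximal_barycentricSubdivision {Δ : Finset (Finset V)} {𝒞 : Finset (Finset V)}
    (h𝒞 : Maximal (· ∈ (univ : Finset (Finset (Finset V))).filter (fun 𝒞 =>
        (∀ A ∈ 𝒞, A.Nonempty ∧ A ∈ Δ.biUnion powerset) ∧ ∀ A ∈ 𝒞, ∀ B ∈ 𝒞, A ⊆ B ∨ B ⊆ A)) 𝒞)
    (hne : 𝒞.Nonempty) :
    ∃ T ∈ 𝒞, Maximal (· ∈ Δ) T ∧ (∀ A ∈ 𝒞, A ⊆ T) ∧ 𝒞.card = T.card := by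
  have hmem := (mem_barycentricSubdivision_iff Δ 𝒞).mp h𝒞.1
  obtain ⟨T, hT, htop⟩ := exists_top_of_chain hne hmem.2
  have hTne : T.Nonempty := (hmem.1 T hT).1
  -- any member of `Δ` containing `T` can be added to the chain, hence lies in it, hence equals `T`
  have hkey : ∀ G ∈ Δ, T ⊆ G → G = T := by
    intro G hG hTG
    have hins : insert G 𝒞 ∈ (univ : Finset (Finset (Finset V))).filter (fun 𝒞 =>
        (∀ A ∈ 𝒞, A.Nonempty ∧ A ∈ Δ.biUnion powerset) ∧ ∀ A ∈ 𝒞, ∀ B ∈ 𝒞, A ⊆ B ∨ B ⊆ A) := by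
      rw [mem_barycentricSubdivision_iff]
      refine ⟨fun A hA => ?_, fun A hA B hB => ?_⟩
      · rcases Finset.mem_insert.mp hA with rfl | hA𝒞
        · exact ⟨hTne.mono hTG, (mem_biUnion_powerset_iff Δ _).mpr ⟨A, hG, subset_rfl⟩⟩
        · exact hmem.1 A hA𝒞
      · rcases Finset.mem_insert.mp hA with hAG | hA𝒞 <;>
          rcases Finset.mem_insert.mp hB with hBG | hB𝒞
        · exact Or.inl (hAG ▸ hBG ▸ subset_rfl)
        · rw [hAG]
          exact Or.inr ((htop B hB𝒞).trans hTG)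
        · rw [hBG]
          exact Or.inl ((htop A hA𝒞).trans hTG)
        · exact hmem.2 A hA𝒞 B hB𝒞
    have hG𝒞 : G ∈ 𝒞 := h𝒞.2 hins (Finset.subset_insert G 𝒞) (Finset.mem_insert_self G 𝒞)
    exact Finset.Subset.antisymm (htop G hG𝒞) hTG
  obtain ⟨G, hG, hTG⟩ := (mem_biUnion_powerset_iff Δ T).mp (hmem.1 T hT).2
  have hTΔ : T ∈ Δ := hkey G hG hTG ▸ hG
  refine ⟨T, hT, ⟨hTΔ, fun G hG hTG => (hkey G hG hTG).le⟩, htop, ?_⟩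
  refine card_eq_card_of_saturated_chain hT (fun A hA => ⟨(hmem.1 A hA).1, htop A hA⟩) hmem.2
    fun M hMne hMT hcomp => ?_
  have hins : insert M 𝒞 ∈ (univ : Finset (Finset (Finset V))).filter (fun 𝒞 =>
      (∀ A ∈ 𝒞, A.Nonempty ∧ A ∈ Δ.biUnion powerset) ∧ ∀ A ∈ 𝒞, ∀ B ∈ 𝒞, A ⊆ B ∨ B ⊆ A) := by
    rw [mem_barycentricSubdivision_iff]
    refine ⟨fun A hA => ?_, fun A hA B hB => ?_⟩
    · rcases Finset.mem_insert.mp hA with rfl | hA𝒞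
      · exact ⟨hMne, (mem_biUnion_powerset_iff Δ _).mpr ⟨T, hTΔ, hMT⟩⟩
      · exact hmem.1 A hA𝒞
    · rcases Finset.mem_insert.mp hA with hAM | hA𝒞 <;>
        rcases Finset.mem_insert.mp hB with hBM | hB𝒞
      · exact Or.inl (hAM ▸ hBM ▸ subset_rfl)
      · rw [hAM]
        exact (hcomp B hB𝒞).symm
      · rw [hBM]
        exact hcomp A hA𝒞
      · exact hmem.2 A hA𝒞 B hB𝒞
  exact h𝒞.2 hins (Finset.subset_insert M 𝒞) (Finset.mem_insert_self M 𝒞)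

/-- **Every nonempty facet `F` of `Δ` is the top of a facet of `bs(Δ)`, which has `|F|` members.**
[cite: ZaareNahandi2015, §1] -/
theorem exists_maximal_barycentricSubdivision_of_maximal {Δ : Finset (Finset V)} {F : Finset V}
    (hF : Maximal (· ∈ Δ) F) (hne : F.Nonempty) :
    ∃ 𝒞 : Finset (Finset V), Maximal (· ∈ (univ : Finset (Finset (Finset V))).filter (fun 𝒞 =>
        (∀ A ∈ 𝒞, A.Nonempty ∧ A ∈ Δ.biUnion powerset) ∧ ∀ A ∈ 𝒞, ∀ B ∈ 𝒞, A ⊆ B ∨ B ⊆ A)) 𝒞 ∧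
      F ∈ 𝒞 ∧ (∀ A ∈ 𝒞, A ⊆ F) ∧ 𝒞.card = F.card := by
  have hsing : ({F} : Finset (Finset V)) ∈ (univ : Finset (Finset (Finset V))).filter (fun 𝒞 =>
      (∀ A ∈ 𝒞, A.Nonempty ∧ A ∈ Δ.biUnion powerset) ∧ ∀ A ∈ 𝒞, ∀ B ∈ 𝒞, A ⊆ B ∨ B ⊆ A) :=
    (singleton_mem_barycentricSubdivision_iff Δ F).mpr
      ⟨hne, (mem_biUnion_powerset_iff Δ F).mpr ⟨F, hF.1, subset_rfl⟩⟩
  obtain ⟨𝒞, hF𝒞, h𝒞⟩ := Finset.exists_le_maximal _ hsing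
  have hFmem : F ∈ 𝒞 := hF𝒞 (Finset.mem_singleton_self F)
  obtain ⟨T, hT, hTmax, htop, hcard⟩ := exists_top_of_maximal_barycentricSubdivision h𝒞 ⟨F, hFmem⟩
  have hTF : T = F := Finset.Subset.antisymm (hF.2 hTmax.1 (htop F hFmem)) (htop F hFmem)
  subst hTF
  exact ⟨𝒞, h𝒞, hFmem, htop, hcard⟩

/-- Every face of `bs(Δ)` has at most `max_{F ∈ Δ} |F|` members. [cite: ZaareNahandi2015, §1
("the dimension … of a simplicial complex and its barycentric subdivision are equal")] -/
theorem card_le_sup_card_of_mem_barycentricSubdivision {Δ : Finset (Finset V)}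
    {𝒞 : Finset (Finset V)}
    (h𝒞 : 𝒞 ∈ (univ : Finset (Finset (Finset V))).filter (fun 𝒞 =>
        (∀ A ∈ 𝒞, A.Nonempty ∧ A ∈ Δ.biUnion powerset) ∧ ∀ A ∈ 𝒞, ∀ B ∈ 𝒞, A ⊆ B ∨ B ⊆ A)) :
    𝒞.card ≤ Δ.sup Finset.card := by
  rw [mem_barycentricSubdivision_iff] at h𝒞
  rcases 𝒞.eq_empty_or_nonempty with rfl | hne
  · exact Nat.zero_le _
  · obtain ⟨T, hT, htop⟩ := exists_top_of_chain hne h𝒞.2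
    obtain ⟨G, hG, hTG⟩ := (mem_biUnion_powerset_iff Δ T).mp (h𝒞.1 T hT).2
    exact (card_chain_le_card h𝒞.2 fun A hA => ⟨(h𝒞.1 A hA).1, (htop A hA).trans hTG⟩).trans
      (Finset.le_sup (f := Finset.card) hG)

/-- **`dim bs(Δ) = dim Δ`: `max {|𝒞| : 𝒞 ∈ bs(Δ)} = max {|F| : F ∈ Δ}`.**
[cite: ZaareNahandi2015, §1 ("the dimension … of a simplicial complex and its barycentric
subdivision are equal ([BW] and [KW])")] -/
theorem sup_card_barycentricSubdivision (Δ : Finset (Finset V)) :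
    ((univ : Finset (Finset (Finset V))).filter (fun 𝒞 =>
        (∀ A ∈ 𝒞, A.Nonempty ∧ A ∈ Δ.biUnion powerset) ∧ ∀ A ∈ 𝒞, ∀ B ∈ 𝒞, A ⊆ B ∨ B ⊆ A)).sup
        Finset.card = Δ.sup Finset.card := by
  apply le_antisymm
  · exact Finset.sup_le fun 𝒞 h𝒞 => card_le_sup_card_of_mem_barycentricSubdivision h𝒞
  · refine Finset.sup_le fun F hF => ?_
    obtain ⟨G, hFG, hG⟩ := Δ.exists_le_maximal hF
    rcases G.eq_empty_or_nonempty with hGe | hGne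
    · rw [hGe] at hFG
      rw [Finset.subset_empty.mp hFG, Finset.card_empty]
      exact Nat.zero_le _
    · obtain ⟨𝒞, h𝒞, -, -, hcard⟩ := exists_maximal_barycentricSubdivision_of_maximal hG hGne
      calc F.card ≤ G.card := Finset.card_le_card hFG
        _ = 𝒞.card := hcard.symm
        _ ≤ _ := Finset.le_sup (f := Finset.card) h𝒞.1

variable {k : Type u} [Field k]

/-- **`dim k[bs(Δ)] = dim k[Δ]`** for a nonempty generating family (Krull dimensions of the two
Stanley–Reisner rings, over the vertex types `Finset V` and `V`; `k` infinite; for `Δ = ∅` the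
right-hand ring is `0` while `bs(∅) = {∅}` gives `k`). [cite: ZaareNahandi2015, §1]
[cite: BrunsHerzog1998, Thm. 5.1.4] -/
theorem ringKrullDim_barycentricSubdivision_eq [Infinite k] {Δ : Finset (Finset V)}
    (hΔ : Δ.Nonempty) :
    ringKrullDim (MvPolynomial (Finset V) k ⧸ projVanishingIdeal {p : Finset V → k |
        ∃ 𝒞 ∈ (univ : Finset (Finset (Finset V))).filter (fun 𝒞 =>
          (∀ A ∈ 𝒞, A.Nonempty ∧ A ∈ Δ.biUnion powerset) ∧ ∀ A ∈ 𝒞, ∀ B ∈ 𝒞, A ⊆ B ∨ B ⊆ A),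
          ∀ i ∉ 𝒞, p i = 0}) =
      ringKrullDim (MvPolynomial V k ⧸ projVanishingIdeal {p : V → k | ∃ F ∈ Δ, ∀ i ∉ F, p i = 0}) := by
  have hne : ((univ : Finset (Finset (Finset V))).filter (fun 𝒞 =>
      (∀ A ∈ 𝒞, A.Nonempty ∧ A ∈ Δ.biUnion powerset) ∧
        ∀ A ∈ 𝒞, ∀ B ∈ 𝒞, A ⊆ B ∨ B ⊆ A)).Nonempty :=
    ⟨∅, (mem_barycentricSubdivision_iff Δ ∅).mpr ⟨fun A hA => absurd hA (Finset.notMem_empty A),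
      fun A hA => absurd hA (Finset.notMem_empty A)⟩⟩
  rw [ringKrullDim_quotient_projVanishingIdeal_coordArrangement_eq_sup_card hne,
    ringKrullDim_quotient_projVanishingIdeal_coordArrangement_eq_sup_card hΔ,
    sup_card_barycentricSubdivision]

end Barycentric

/-! ### § 3 `Δ` is pure iff `bs(Δ)` is pure -/

section Pure

variable [Fintype V]

omit [DecidableEq V] [Fintype V] in
/-- If the empty set is a facet of `Δ`, it is the only member. [cite: BrunsHerzog1998, Def. 5.1.1] -/
theorem eq_empty_of_mem_of_maximal_empty {Δ : Finset (Finset V)} (h : Maximal (· ∈ Δ) (∅ : Finset V))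
    {F : Finset V} (hF : F ∈ Δ) : F = ∅ :=
  Finset.subset_empty.mp (h.2 hF (Finset.empty_subset F))

/-- If the empty chain is a facet of `bs(Δ)`, it is the only face. [cite: ZaareNahandi2015, §1] -/
theorem eq_empty_of_mem_of_maximal_barycentricSubdivision_empty {Δ : Finset (Finset V)}
    (h : Maximal (· ∈ (univ : Finset (Finset (Finset V))).filter (fun 𝒞 =>
        (∀ A ∈ 𝒞, A.Nonempty ∧ A ∈ Δ.biUnion powerset) ∧ ∀ A ∈ 𝒞, ∀ B ∈ 𝒞, A ⊆ B ∨ B ⊆ A))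
      (∅ : Finset (Finset V)))
    {𝒞 : Finset (Finset V)}
    (h𝒞 : 𝒞 ∈ (univ : Finset (Finset (Finset V))).filter (fun 𝒞 =>
        (∀ A ∈ 𝒞, A.Nonempty ∧ A ∈ Δ.biUnion powerset) ∧ ∀ A ∈ 𝒞, ∀ B ∈ 𝒞, A ⊆ B ∨ B ⊆ A)) :
    𝒞 = ∅ :=
  Finset.subset_empty.mp (h.2 h𝒞 (Finset.empty_subset 𝒞))

/-- **"A simplicial complex `Δ` is pure if and only if its barycentric subdivision is pure."**
[cite: ZaareNahandi2015, §1] -/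
theorem barycentricSubdivision_pure_iff (Δ : Finset (Finset V)) :
    (∀ 𝒞 𝒞' : Finset (Finset V),
        Maximal (· ∈ (univ : Finset (Finset (Finset V))).filter (fun 𝒞 =>
          (∀ A ∈ 𝒞, A.Nonempty ∧ A ∈ Δ.biUnion powerset) ∧ ∀ A ∈ 𝒞, ∀ B ∈ 𝒞, A ⊆ B ∨ B ⊆ A)) 𝒞 →
        Maximal (· ∈ (univ : Finset (Finset (Finset V))).filter (fun 𝒞 =>
          (∀ A ∈ 𝒞, A.Nonempty ∧ A ∈ Δ.biUnion powerset) ∧ ∀ A ∈ 𝒞, ∀ B ∈ 𝒞, A ⊆ B ∨ B ⊆ A)) 𝒞' →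
        𝒞.card = 𝒞'.card) ↔
      ∀ F F' : Finset V, Maximal (· ∈ Δ) F → Maximal (· ∈ Δ) F' → F.card = F'.card := by
  constructor
  · intro h F F' hF hF'
    rcases F.eq_empty_or_nonempty with rfl | hFne
    · rw [eq_empty_of_mem_of_maximal_empty hF hF'.1]
    rcases F'.eq_empty_or_nonempty with rfl | hF'ne
    · rw [eq_empty_of_mem_of_maximal_empty hF' hF.1]
    obtain ⟨𝒞, h𝒞, -, -, hc⟩ := exists_maximal_barycentricSubdivision_of_maximal hF hFne
    obtain ⟨𝒞', h𝒞', -, -, hc'⟩ := exists_maximal_barycentricSubdivision_of_maximal hF' hF'ne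
    rw [← hc, ← hc', h 𝒞 𝒞' h𝒞 h𝒞']
  · intro h 𝒞 𝒞' h𝒞 h𝒞'
    rcases 𝒞.eq_empty_or_nonempty with rfl | hne
    · rw [eq_empty_of_mem_of_maximal_barycentricSubdivision_empty h𝒞 h𝒞'.1]
    rcases 𝒞'.eq_empty_or_nonempty with rfl | hne'
    · rw [eq_empty_of_mem_of_maximal_barycentricSubdivision_empty h𝒞' h𝒞.1]
    obtain ⟨T, -, hT, -, hc⟩ := exists_top_of_maximal_barycentricSubdivision h𝒞 hne
    obtain ⟨T', -, hT', -, hc'⟩ := exists_top_of_maximal_barycentricSubdivision h𝒞' hne'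
    rw [hc, hc', h T T' hT hT']

end Pure

/-! ### § 4 The minimal non-faces and the Stanley–Reisner ideal of `bs(Δ)` -/

section Nonfaces

variable [Fintype V]

/-- **The non-faces of `bs(Δ)`**: a family of subsets of `V` lies in no face of `bs(Δ)` iff it
contains a non-vertex (a subset that is not a nonempty face of `Δ`) or two non-comparable members
("the minimal non-faces of `bs(Δ)` are subsets of `Δ` with exactly two non-comparable elements").
[cite: ZaareNahandi2015, §1] -/
theorem forall_barycentricSubdivision_not_subset_iff (Δ : Finset (Finset V)) (𝒢 : Finset (Finset V)) :
    (∀ 𝒞 ∈ (↑((univ : Finset (Finset (Finset V))).filter (fun 𝒞 =>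
        (∀ A ∈ 𝒞, A.Nonempty ∧ A ∈ Δ.biUnion powerset) ∧ ∀ A ∈ 𝒞, ∀ B ∈ 𝒞, A ⊆ B ∨ B ⊆ A)) :
        Set (Finset (Finset V))), ¬ 𝒢 ⊆ 𝒞) ↔
      ∃ M ∈ ({M : Finset (Finset V) | ∃ A, ¬ (A.Nonempty ∧ A ∈ Δ.biUnion powerset) ∧ M = {A}} ∪
          {M | ∃ A B, (A.Nonempty ∧ A ∈ Δ.biUnion powerset) ∧ (B.Nonempty ∧ B ∈ Δ.biUnion powerset) ∧
            ¬ A ⊆ B ∧ ¬ B ⊆ A ∧ M = {A, B}}), M ⊆ 𝒢 := by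
  constructor
  · intro h
    by_contra hnot
    refine h 𝒢 (Finset.mem_coe.mpr ((mem_barycentricSubdivision_iff Δ 𝒢).mpr ⟨fun A hA => ?_,
      fun A hA B hB => ?_⟩)) subset_rfl
    · by_contra hA'
      exact hnot ⟨{A}, Set.mem_union_left _ ⟨A, hA', rfl⟩, Finset.singleton_subset_iff.mpr hA⟩
    · by_contra hAB
      push Not at hAB
      by_cases hA' : A.Nonempty ∧ A ∈ Δ.biUnion powerset
      · by_cases hB' : B.Nonempty ∧ B ∈ Δ.biUnion powerset
        · exact hnot ⟨{A, B}, Set.mem_union_right _ ⟨A, B, hA', hB', hAB.1, hAB.2, rfl⟩,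
            Finset.insert_subset hA (Finset.singleton_subset_iff.mpr hB)⟩
        · exact hnot ⟨{B}, Set.mem_union_left _ ⟨B, hB', rfl⟩, Finset.singleton_subset_iff.mpr hB⟩
      · exact hnot ⟨{A}, Set.mem_union_left _ ⟨A, hA', rfl⟩, Finset.singleton_subset_iff.mpr hA⟩
  · rintro ⟨M, hM, hM𝒢⟩ 𝒞 h𝒞 h𝒢𝒞
    rw [Finset.mem_coe, mem_barycentricSubdivision_iff] at h𝒞
    rcases hM with ⟨A, hA, rfl⟩ | ⟨A, B, -, -, hAB, hBA, rfl⟩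
    · exact hA (h𝒞.1 A (h𝒢𝒞 (hM𝒢 (Finset.mem_singleton_self A))))
    · have hA := h𝒢𝒞 (hM𝒢 (Finset.mem_insert_self A {B}))
      have hB := h𝒢𝒞 (hM𝒢 (Finset.mem_insert_of_mem (Finset.mem_singleton_self B)))
      rcases h𝒞.2 A hA B hB with h | h
      · exact hAB h
      · exact hBA h

variable {k : Type u} [Field k]

/-- **The Stanley–Reisner ideal of `bs(Δ)` is generated by the non-vertices `x_A` (`A` not a nonempty
face) and the products `x_A x_B` of non-comparable nonempty faces** (`k` infinite).
[cite: ZaareNahandi2015, §1 ("the minimal non-faces of bs(Δ) are subsets of Δ with exactly two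
non-comparable elements")] -/
theorem projVanishingIdeal_barycentricSubdivision_eq_span [Infinite k] (Δ : Finset (Finset V)) :
    projVanishingIdeal {p : Finset V → k |
        ∃ 𝒞 ∈ (univ : Finset (Finset (Finset V))).filter (fun 𝒞 =>
          (∀ A ∈ 𝒞, A.Nonempty ∧ A ∈ Δ.biUnion powerset) ∧ ∀ A ∈ 𝒞, ∀ B ∈ 𝒞, A ⊆ B ∨ B ⊆ A),
          ∀ i ∉ 𝒞, p i = 0} =
      Ideal.span ({f : MvPolynomial (Finset V) k | ∃ A, ¬ (A.Nonempty ∧ A ∈ Δ.biUnion powerset) ∧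
          f = X A} ∪
        {f | ∃ A B, (A.Nonempty ∧ A ∈ Δ.biUnion powerset) ∧ (B.Nonempty ∧ B ∈ Δ.biUnion powerset) ∧
          ¬ A ⊆ B ∧ ¬ B ⊆ A ∧ f = X A * X B}) := by
  have hset : {p : Finset V → k | ∃ 𝒞 ∈ (univ : Finset (Finset (Finset V))).filter (fun 𝒞 =>
        (∀ A ∈ 𝒞, A.Nonempty ∧ A ∈ Δ.biUnion powerset) ∧ ∀ A ∈ 𝒞, ∀ B ∈ 𝒞, A ⊆ B ∨ B ⊆ A),
        ∀ i ∉ 𝒞, p i = 0} =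
      {p : Finset V → k | ∃ 𝒞 ∈ (↑((univ : Finset (Finset (Finset V))).filter (fun 𝒞 =>
        (∀ A ∈ 𝒞, A.Nonempty ∧ A ∈ Δ.biUnion powerset) ∧ ∀ A ∈ 𝒞, ∀ B ∈ 𝒞, A ⊆ B ∨ B ⊆ A)) :
        Set (Finset (Finset V))), ∀ i ∉ 𝒞, p i = 0} := Set.ext fun _ => Iff.rfl
  rw [hset, projVanishingIdeal_coordArrangement_eq_span_of_nonfaces _ _
    (forall_barycentricSubdivision_not_subset_iff Δ)]
  congr 1
  ext f
  simp only [Set.mem_image, Set.mem_union, Set.mem_setOf_eq]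
  constructor
  · rintro ⟨M, hM | hM, rfl⟩
    · obtain ⟨A, hA, rfl⟩ := hM
      exact Or.inl ⟨A, hA, by rw [Finset.prod_singleton]⟩
    · obtain ⟨A, B, hA, hB, hAB, hBA, rfl⟩ := hM
      refine Or.inr ⟨A, B, hA, hB, hAB, hBA, ?_⟩
      have hne : A ≠ B := fun h => hAB (h ▸ subset_rfl)
      rw [Finset.prod_pair hne]
  · rintro (⟨A, hA, rfl⟩ | ⟨A, B, hA, hB, hAB, hBA, rfl⟩)
    · exact ⟨{A}, Or.inl ⟨A, hA, rfl⟩, by rw [Finset.prod_singleton]⟩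
    · have hne : A ≠ B := fun h => hAB (h ▸ subset_rfl)
      exact ⟨{A, B}, Or.inr ⟨A, B, hA, hB, hAB, hBA, rfl⟩, by rw [Finset.prod_pair hne]⟩

end Nonfaces

/-! ### § 5 The non-comparability graph `G(Δ)` and Lemma 2.1 -/

section Graph

variable [Fintype V]

/-- A finite set of nonempty faces is a chain iff it is an independent set of the
**non-comparability graph `G(Δ)`** `a ∼ b ⟺ a ⊄ b ∧ b ⊄ a` ("two vertices are adjacent if their
corresponding faces are not comparable"). [cite: ZaareNahandi2015, §1] -/
theorem mem_orderComplex_iff_isIndepSet_noncomparability (Δ : Finset (Finset V))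
    (F : Finset {A : Finset V // A.Nonempty ∧ A ∈ Δ.biUnion powerset}) :
    F ∈ (univ : Finset (Finset {A : Finset V // A.Nonempty ∧ A ∈ Δ.biUnion powerset})).filter
        (fun F => ∀ a ∈ F, ∀ b ∈ F, a ≤ b ∨ b ≤ a) ↔
      (SimpleGraph.fromRel
        (fun a b : {A : Finset V // A.Nonempty ∧ A ∈ Δ.biUnion powerset} => ¬ a ≤ b ∧ ¬ b ≤ a)).IsIndepSet
        ↑F := by
  rw [Finset.mem_filter]
  simp only [Finset.mem_univ, true_and]
  constructor
  · intro h a ha b hb _ hadj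
    rw [SimpleGraph.fromRel_adj] at hadj
    rcases h a (Finset.mem_coe.mp ha) b (Finset.mem_coe.mp hb) with hab | hba
    · rcases hadj.2 with ⟨h1, -⟩ | ⟨-, h1⟩
      · exact h1 hab
      · exact h1 hab
    · rcases hadj.2 with ⟨-, h2⟩ | ⟨h2, -⟩
      · exact h2 hba
      · exact h2 hba
  · intro h a ha b hb
    by_cases hab : a = b
    · exact Or.inl hab.le
    · by_contra hnot
      push Not at hnot
      exact h (Finset.mem_coe.mpr ha) (Finset.mem_coe.mpr hb) hab
        ((SimpleGraph.fromRel_adj _ _ _).mpr ⟨hab, Or.inl hnot⟩)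

/-- On the type `P` of nonempty faces of `Δ`, the faces of the order complex (chains for the
inclusion order, gen30-#9) are exactly the independent sets of the **non-comparability graph `G(Δ)`**
("two vertices are adjacent if their corresponding faces are not comparable"): `bs(Δ) = Δ(G(Δ))`.
[cite: ZaareNahandi2015, §1] -/
theorem orderComplex_eq_independenceComplex_noncomparability (Δ : Finset (Finset V)) :
    (univ : Finset (Finset {A : Finset V // A.Nonempty ∧ A ∈ Δ.biUnion powerset})).filter
        (fun F => ∀ a ∈ F, ∀ b ∈ F, a ≤ b ∨ b ≤ a) =
      (univ : Finset (Finset {A : Finset V // A.Nonempty ∧ A ∈ Δ.biUnion powerset})).filter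
        (fun F => ∀ a ∈ F, ∀ b ∈ F, ¬ (SimpleGraph.fromRel
          (fun a b : {A : Finset V // A.Nonempty ∧ A ∈ Δ.biUnion powerset} => ¬ a ≤ b ∧ ¬ b ≤ a)).Adj
            a b) := by
  refine Finset.filter_congr fun F _ => ?_
  have h := mem_orderComplex_iff_isIndepSet_noncomparability Δ F
  rw [Finset.mem_filter] at h
  simp only [Finset.mem_univ, true_and] at h
  rw [h]
  exact (forall_not_adj_iff_isIndepSet _ F).symm

/-- **The forgetful embedding identifies the order complex of the poset of nonempty faces with
`bs(Δ)`**: a finite family of nonempty faces is a chain iff its image in `Finset (Finset V)` is a face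
of `bs(Δ)`. [cite: ZaareNahandi2015, §1] -/
theorem map_subtype_mem_barycentricSubdivision_iff (Δ : Finset (Finset V))
    (F : Finset {A : Finset V // A.Nonempty ∧ A ∈ Δ.biUnion powerset}) :
    F.map (Function.Embedding.subtype _) ∈ (univ : Finset (Finset (Finset V))).filter (fun 𝒞 =>
        (∀ A ∈ 𝒞, A.Nonempty ∧ A ∈ Δ.biUnion powerset) ∧ ∀ A ∈ 𝒞, ∀ B ∈ 𝒞, A ⊆ B ∨ B ⊆ A) ↔
      F ∈ (univ : Finset (Finset {A : Finset V // A.Nonempty ∧ A ∈ Δ.biUnion powerset})).filter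
        (fun F => ∀ a ∈ F, ∀ b ∈ F, a ≤ b ∨ b ≤ a) := by
  rw [mem_barycentricSubdivision_iff, Finset.mem_filter]
  simp only [Finset.mem_map, Function.Embedding.coe_subtype, forall_exists_index, and_imp,
    Finset.mem_univ, true_and]
  constructor
  · rintro ⟨-, h⟩ a ha b hb
    exact h a.1 a ha rfl b.1 b hb rfl
  · intro h
    refine ⟨?_, ?_⟩
    · rintro A a - rfl
      exact a.2
    · rintro A a ha rfl B b hb rfl
      exact h a ha b hb

/-- Every face of `bs(Δ)` is the image of a chain of the poset of nonempty faces.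
[cite: ZaareNahandi2015, §1] -/
theorem exists_map_subtype_eq_of_mem_barycentricSubdivision (Δ : Finset (Finset V))
    {𝒞 : Finset (Finset V)}
    (h𝒞 : 𝒞 ∈ (univ : Finset (Finset (Finset V))).filter (fun 𝒞 =>
        (∀ A ∈ 𝒞, A.Nonempty ∧ A ∈ Δ.biUnion powerset) ∧ ∀ A ∈ 𝒞, ∀ B ∈ 𝒞, A ⊆ B ∨ B ⊆ A)) :
    ∃ F : Finset {A : Finset V // A.Nonempty ∧ A ∈ Δ.biUnion powerset},
      F.map (Function.Embedding.subtype _) = 𝒞 := by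
  refine ⟨𝒞.subtype _, ?_⟩
  rw [Finset.subtype_map, Finset.filter_true_of_mem]
  exact fun A hA => ((mem_barycentricSubdivision_iff Δ 𝒞).mp h𝒞).1 A hA

/-- **Facets correspond**: `F` is a facet of the order complex of the nonempty faces iff its image
is a facet of `bs(Δ)`. [cite: ZaareNahandi2015, §1] -/
theorem maximal_map_subtype_iff (Δ : Finset (Finset V))
    (F : Finset {A : Finset V // A.Nonempty ∧ A ∈ Δ.biUnion powerset}) :
    Maximal (· ∈ (univ : Finset (Finset (Finset V))).filter (fun 𝒞 =>
        (∀ A ∈ 𝒞, A.Nonempty ∧ A ∈ Δ.biUnion powerset) ∧ ∀ A ∈ 𝒞, ∀ B ∈ 𝒞, A ⊆ B ∨ B ⊆ A))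
        (F.map (Function.Embedding.subtype _)) ↔
      Maximal (· ∈ (univ : Finset (Finset {A : Finset V // A.Nonempty ∧ A ∈ Δ.biUnion powerset})).filter
        (fun F => ∀ a ∈ F, ∀ b ∈ F, a ≤ b ∨ b ≤ a)) F := by
  constructor
  · rintro ⟨hF, hmax⟩
    refine ⟨(map_subtype_mem_barycentricSubdivision_iff Δ F).mp hF, fun F' hF' hFF' => ?_⟩
    have h := hmax ((map_subtype_mem_barycentricSubdivision_iff Δ F').mpr hF')
      (Finset.map_subset_map.mpr hFF')
    exact Finset.map_subset_map.mp h
  · rintro ⟨hF, hmax⟩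
    refine ⟨(map_subtype_mem_barycentricSubdivision_iff Δ F).mpr hF, fun 𝒞' h𝒞' hF𝒞' => ?_⟩
    obtain ⟨F', rfl⟩ := exists_map_subtype_eq_of_mem_barycentricSubdivision Δ h𝒞'
    exact Finset.map_subset_map.mpr (hmax ((map_subtype_mem_barycentricSubdivision_iff Δ F').mp h𝒞')
      (Finset.map_subset_map.mp hF𝒞'))

/-- **The order complex of the poset of nonempty faces is pure iff `Δ` is pure.**
[cite: ZaareNahandi2015, §1] -/
theorem orderComplex_faces_pure_iff (Δ : Finset (Finset V)) :
    (∀ F F' : Finset {A : Finset V // A.Nonempty ∧ A ∈ Δ.biUnion powerset},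
        Maximal (· ∈ (univ : Finset (Finset {A : Finset V // A.Nonempty ∧ A ∈ Δ.biUnion powerset})).filter
          (fun F => ∀ a ∈ F, ∀ b ∈ F, a ≤ b ∨ b ≤ a)) F →
        Maximal (· ∈ (univ : Finset (Finset {A : Finset V // A.Nonempty ∧ A ∈ Δ.biUnion powerset})).filter
          (fun F => ∀ a ∈ F, ∀ b ∈ F, a ≤ b ∨ b ≤ a)) F' → F.card = F'.card) ↔
      ∀ F F' : Finset V, Maximal (· ∈ Δ) F → Maximal (· ∈ Δ) F' → F.card = F'.card := by
  rw [← barycentricSubdivision_pure_iff Δ]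
  constructor
  · intro h 𝒞 𝒞' h𝒞 h𝒞'
    obtain ⟨F, rfl⟩ := exists_map_subtype_eq_of_mem_barycentricSubdivision Δ h𝒞.1
    obtain ⟨F', rfl⟩ := exists_map_subtype_eq_of_mem_barycentricSubdivision Δ h𝒞'.1
    rw [Finset.card_map, Finset.card_map]
    exact h F F' ((maximal_map_subtype_iff Δ F).mp h𝒞) ((maximal_map_subtype_iff Δ F').mp h𝒞')
  · intro h F F' hF hF'
    have h' := h _ _ ((maximal_map_subtype_iff Δ F).mpr hF) ((maximal_map_subtype_iff Δ F').mpr hF')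
    rwa [Finset.card_map, Finset.card_map] at h'

/-- **Lemma 2.1: "`Δ` is pure if and only if `G(Δ)` is well-covered"** (all maximal independent sets
of the non-comparability graph of the nonempty faces have the same cardinality).
[cite: ZaareNahandi2015, Lemma 2.1] -/
theorem pure_iff_noncomparabilityGraph_wellCovered (Δ : Finset (Finset V)) :
    (∀ F F' : Finset V, Maximal (· ∈ Δ) F → Maximal (· ∈ Δ) F' → F.card = F'.card) ↔
      ∀ F F' : Finset {A : Finset V // A.Nonempty ∧ A ∈ Δ.biUnion powerset},
        Maximal (fun S : Finset {A : Finset V // A.Nonempty ∧ A ∈ Δ.biUnion powerset} =>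
          (SimpleGraph.fromRel (fun a b : {A : Finset V // A.Nonempty ∧ A ∈ Δ.biUnion powerset} =>
            ¬ a ≤ b ∧ ¬ b ≤ a)).IsIndepSet ↑S) F →
        Maximal (fun S : Finset {A : Finset V // A.Nonempty ∧ A ∈ Δ.biUnion powerset} =>
          (SimpleGraph.fromRel (fun a b : {A : Finset V // A.Nonempty ∧ A ∈ Δ.biUnion powerset} =>
            ¬ a ≤ b ∧ ¬ b ≤ a)).IsIndepSet ↑S) F' → F.card = F'.card := by
  rw [← orderComplex_faces_pure_iff Δ]
  have h : (· ∈ (univ : Finset (Finset {A : Finset V // A.Nonempty ∧ A ∈ Δ.biUnion powerset})).filter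
      (fun F => ∀ a ∈ F, ∀ b ∈ F, a ≤ b ∨ b ≤ a)) =
      fun S : Finset {A : Finset V // A.Nonempty ∧ A ∈ Δ.biUnion powerset} =>
        (SimpleGraph.fromRel (fun a b : {A : Finset V // A.Nonempty ∧ A ∈ Δ.biUnion powerset} =>
          ¬ a ≤ b ∧ ¬ b ≤ a)).IsIndepSet ↑S :=
    funext fun S => propext (mem_orderComplex_iff_isIndepSet_noncomparability Δ S)
  rw [h]

end Graph

/-! ### § 6 Example -/

/-- The complex generated by an edge `{0,1}` and a disjoint vertex `{2}` is not pure (facets of sizes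
`2` and `1`); accordingly `bs` has the facets `{{0},{0,1}}`, `{{1},{0,1}}` (size `2`) and `{{2}}`
(size `1`). [cite: ZaareNahandi2015, §1] (example) -/
example : ((univ : Finset (Finset (Finset (Fin 3)))).filter (fun 𝒞 =>
      (∀ A ∈ 𝒞, A.Nonempty ∧ A ∈ ({{0, 1}, {2}} : Finset (Finset (Fin 3))).biUnion powerset) ∧
        ∀ A ∈ 𝒞, ∀ B ∈ 𝒞, A ⊆ B ∨ B ⊆ A)).filter (fun 𝒞 => 𝒞.card = 2) =
    {{{0}, {0, 1}}, {{1}, {0, 1}}} := by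
  decide

end Literature.AlgebraicGeometry.ProjectiveSpace
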